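import Summits.NavierStokesRegularity.FluidComputer.GateBudgetLadderStepSwing
import HarnessLib

/-!
# GateBudget part 120 — the pair ladder's step as a lemma, every winding number k (§317–§318)

Cell `pub-fluidc`, blueprint seat bp1 (gen 41, SPEC-INPUT-bp1 §CO(4)(b): "general k — the
paper's stated generality"); namespace `Summit.NavierStokesRegularity.FluidComputer.GateBudget`,
headline member `RotorKnob.rotorCircuit K K¹⁰ ε ρ` of the two-scale family from `delayInit`
(5.6), `K ≥ 16`, `ε² ≤ 1/(6K²⁰)`, on the lattice window `200ε/K²⁰ ≤ ρ² ≤ 2ε/K¹⁰`, `ε = kK¹⁰ρ²`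
for an ARBITRARY winding number `k ≥ 1` (part 117 is the unit lattice `k = 1`); modes `0 = a`
(carrier), `1 = b` (clock), `2 = c` (trigger), `3 = d` (transfer), `4 = ã` (output). HONEST
FRAMING: a low prior, high value-of-information experiment on Tao's machine paradigm; NOT a
claim that NS blows up.

WHY. The clean dud horizon was made ONE two-sided object in parts 118/119 — but on the unit
lattice only: the floor there is the swing ladder (parts 105–108, 117), whose gain over the
crude rung price needs the phase pinning `Φ₁ ≈ α₁ = 0.2507` of `k = 1`. For a general winding
number the sufficiency side already exists rung by rung: part 97 §272 `knob_ladder_climb_pair`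
climbs the √P pair ledger with part 90's ceiling `U ≥ 7/2 + k²/3 + (2 log k + 520 log K)D²`
for every `k`, and part 98 §273 runs it from `delayInit` for `k ≤ K²`. As with part 107 before
part 117, its induction is INLINE — it hands out the `n`-th rung one `n` at a time and never
says that consecutive rungs are a pulse apart, which is what the necessity side (part 72 §219:
ANY pulse-separated run of clean ignitions has `N ≤ K⁹/7 + 1` members, every `k`) and part
118 §313's `cleanHorizon` quantify over. This file is part 117 for general `k`: the step of
part 97's climb as a lemma, so that part 121 can state the clean dud horizon of EVERY lattice
member two-sidedly, about the one object `cleanHorizon K ε ρ X Θ`.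
WHAT. §317 `knob_ladder_pair_rung` — part 97 §272 read through part 117 §309's rung invariant
`SwingRung K ε ρ X k r₀ P₁ A₀ D₀ U δ L n r θ` (whose eleven clauses are LITERALLY part 97's
conclusion at index `n` — part 107 changed part 97's hypotheses, not its conclusion — so the
proof is `exact` part 97). §318 `knob_ladder_step_pair` — THE STEP, every `k`: under part 97's
standing hypotheses (anchor `r₀ ≥ 0`, `P(r₀) ≤ P₁`, `A₀ ≥ 0`, `|d(r₀)| ≤ D₀`; ledgers `D`, `U ≥
7/2 + k²/3 + (2 log k + 520 log K)D²`, the ã-free slip `δ`, the sharp loss `L ≤ 42/K⁹`, `N - 1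
≤ K⁹`, the √-window at `N`), if `1 ≤ m`, `m + 1 ≤ N` and `(r, θ)` is a rung of index `m`, then
there is a rung `(r', θ')` of index `m + 1` with `r' ≥ r + 1` (beyond the pulse `r < T'` and
the cold half `T' + 1 ≤ t_z < r'`, so beyond `r + 242/K⁹`).
HOW. The `succ` case of part 97 §272 VERBATIM (pulse debit and ceiling part 90 §261, √P slip
part 96 §270, cold credit part 92 / cold half part 87, balance part 93, ledger steps parts
81/96, clock floor part 94), with the induction hypothesis replaced by `SwingRung … m r θ` and
the extra conclusion `r + 1 ≤ r'` read off `r < T'`, `T' + 1 ≤ t_z`, `t_z < r'` — line for line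
part 117 §310 with part 97's three `k`-general hunks (`clock_slip_signs`; `u ≥ 7/2/K⁹` from
`U`; the rung ceiling `ã(T') ≤ ã(r) + U/K⁹` from part 90's `hceil` and `d(r)² ≤ D²`) restored
in place of part 106 §288c's swing price. No new analysis.
HONEST LIMITS. (i) existence of a next rung, no uniqueness; (ii) the invariant and its slack
are part 97's (`U ≈ 3.83 + k²/3` per rung against part 72's leak floor `1/K⁹`: the two-sided
window this feeds, part 121, is a factor `≈ 3.8 + k²/3` wide, and at `k = 1` part 118's swing
window `[0.065, 0.1132]K⁹` is the sharper statement); (iii) `k ≤ K²` enters only downstream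
(part 98's ledgers), the step itself is stated for every `k`; (iv) nothing about Navier–Stokes:
these are inequalities about Tao's five-mode toy circuit (5.5)/(5.6).
[cite: Tao2016AveragedNS, §5.5 Theorem 5.3, (5.5), (5.6), (b-eq), (c-eq), (d-eq), (ta-eq),
(energy-con), (est)]
-/

noncomputable section

namespace Summit.NavierStokesRegularity.FluidComputer.GateBudget

open Real Set Filter Topology
open Literature.Analysis.FluidPDE.Tao2016AveragedNS

variable {K ε ρ : ℝ} {X : ℝ → Fin 5 → ℝ} {C : ℝ → ℝ}

/-! ## §317 The pair ladder read through the rung invariant -/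

/-- §317 PART 97 READ THROUGH THE RUNG INVARIANT (every winding number `k`): under part 97 §272
`knob_ladder_climb_pair`'s hypotheses VERBATIM, for every `1 ≤ n ≤ N` there is a rung `(r, θ)`
with `SwingRung K ε ρ X k r₀ P₁ A₀ D₀ U δ L n r θ` — `exact` part 97: part 117 §309's definition
unfolds to part 97's conclusion clause for clause (the swing ladder of part 107 changed part
97's HYPOTHESES — the rung price `U` — and kept its conclusion). [derived: part 97 §272, part
117 §309] -/
theorem knob_ladder_pair_rung
    (hX : ∀ t, HasDerivAt X (RotorKnob.rotorCircuit K (K ^ 10) ε ρ (X t)) t)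
    (h0 : X 0 = delayInit) (hC : ∀ t, HasDerivAt C (X t 2) t) (hK : 16 ≤ K)
    (hε : 0 < ε) (hεK : ε ^ 2 ≤ 1 / (6 * K ^ 20)) (hρ : 0 < ρ)
    (hlo : 200 * ε / K ^ 20 ≤ ρ ^ 2) (hhi : K ^ 10 * ρ ^ 2 ≤ 2 * ε) (k : ℕ)
    (hk : ε = k * K ^ 10 * ρ ^ 2) {r₀ θ₀ P₁ A₀ D₀ D U δ L : ℝ} {N : ℕ} (hr₀ : 0 ≤ r₀)
    (hb₀ : X r₀ 1 = θ₀ * ε) (hc₀ : X r₀ 2 = ρ ^ 2 / K ^ 9) (hP₁ : X r₀ 3 ^ 2 + X r₀ 4 ^ 2 ≤ P₁)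
    (hθ₀lo : 139 / 100 - L ≤ θ₀) (hθ₀hi : θ₀ ≤ 29 / 20)
    (hL42 : L ≤ 42 / K ^ 9) (hN9 : (N : ℝ) - 1 ≤ K ^ 9)
    (hA0 : 0 ≤ A₀) (hA₀ : A₀ ≤ X r₀ 4) (hD₀ : |X r₀ 3| ≤ D₀)
    (hD : D₀ + (1 + 10 / 9 * K ^ 4) * ((61 / 12 * k + 2 / 3) / K ^ 10 + 3 / K ^ 9) ≤ D)
    (hU : 7 / 2 + k ^ 2 / 3 + (2 * log k + 520 * log K) * D ^ 2 ≤ U)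
    (hδ : (2 * D + (2 * k + 3) / (5 * K ^ 9)) * ((2 * k + 3) / (5 * K ^ 9))
      + 6 * (D + (2 * k + 3) / (5 * K ^ 9) + 3 / K ^ 9) / K ^ 9 ≤ δ)
    (hL : 242 * log K / K ^ 10 + 37 * (D + (2 * k + 3) / (5 * K ^ 9) + 4 / K ^ 9) / K ^ 9 ≤ L)
    (hNW : (√P₁ + ((N : ℝ) - 1) * (U / K ^ 9) + δ * K ^ 9 / 2 * log N) ^ 2
      + (3 * (k * π / ((25 / 16 - 1 / 10 ^ 6) * K ^ 10 - 1) + 1 / K ^ 19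
      + 310 * log K / K ^ 9) / 10 + 6 / K ^ 9) + δ ≤ 1 / 50) :
    ∀ n : ℕ, 1 ≤ n → n ≤ N → ∃ r θ : ℝ, SwingRung K ε ρ X k r₀ P₁ A₀ D₀ U δ L n r θ :=
  knob_ladder_climb_pair hX h0 hC hK hε hεK hρ hlo hhi k hk hr₀ hb₀ hc₀ hP₁ hθ₀lo hθ₀hi hL42 hN9
    hA0 hA₀ hD₀ hD hU hδ hL hNW

/-! ## §318 The step of the pair ladder -/

/-- §318 **THE STEP OF THE PAIR LADDER, EVERY WINDING NUMBER k** (headline member from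
`delayInit` with a trigger primitive `C`, `K ≥ 16`, `0 < ε`, `ε² ≤ 1/(6K²⁰)`, `0 < ρ`, `200ε/K²⁰
≤ ρ²`, `K¹⁰ρ² ≤ 2ε`, `ε = kK¹⁰ρ²`; part 97 §272's standing hypotheses VERBATIM except that of the
anchor only `r₀ ≥ 0`, `P(r₀) ≤ P₁`, `A₀ ≥ 0`, `|d(r₀)| ≤ D₀` are kept — ledgers `D`, `U ≥ 7/2 +
k²/3 + (2 log k + 520 log K)D²`, the ã-free slip `δ`, the sharp loss `L ≤ 42/K⁹`, `N - 1 ≤ K⁹`,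
the √-window). IF `1 ≤ m`, `m + 1 ≤ N` and `(r, θ)` is a rung of index `m` (`SwingRung … m r
θ`), THEN there is a rung `(r', θ')` of index `m + 1` with `r' ≥ r + 1`: the pulse from `r` ends
at `T' > r` (part 90), the cold half re-ignites at `r' > t_z ≥ T' + 1` (part 92 / part 87), and
every clause of the invariant advances exactly as in part 97's induction step — which this is,
as a lemma (part 117 §310 with part 97's `k`-general rung price). [derived: part 97 §272 (succ
case verbatim), part 117 §310, part 90 §261, part 96 §270, part 92 §265, part 87 §255, part 93,
part 94, part 81 §238] -/
theorem knob_ladder_step_pair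
    (hX : ∀ t, HasDerivAt X (RotorKnob.rotorCircuit K (K ^ 10) ε ρ (X t)) t)
    (h0 : X 0 = delayInit) (hC : ∀ t, HasDerivAt C (X t 2) t) (hK : 16 ≤ K)
    (hε : 0 < ε) (hεK : ε ^ 2 ≤ 1 / (6 * K ^ 20)) (hρ : 0 < ρ)
    (hlo : 200 * ε / K ^ 20 ≤ ρ ^ 2) (hhi : K ^ 10 * ρ ^ 2 ≤ 2 * ε) (k : ℕ)
    (hk : ε = k * K ^ 10 * ρ ^ 2) {r₀ P₁ A₀ D₀ D U δ L : ℝ} {N : ℕ}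
    (hr₀ : 0 ≤ r₀) (hP₁ : X r₀ 3 ^ 2 + X r₀ 4 ^ 2 ≤ P₁)
    (hL42 : L ≤ 42 / K ^ 9) (hN9 : (N : ℝ) - 1 ≤ K ^ 9)
    (hA0 : 0 ≤ A₀) (hD₀ : |X r₀ 3| ≤ D₀)
    (hD : D₀ + (1 + 10 / 9 * K ^ 4) * ((61 / 12 * k + 2 / 3) / K ^ 10 + 3 / K ^ 9) ≤ D)
    (hU : 7 / 2 + k ^ 2 / 3 + (2 * log k + 520 * log K) * D ^ 2 ≤ U)
    (hδ : (2 * D + (2 * k + 3) / (5 * K ^ 9)) * ((2 * k + 3) / (5 * K ^ 9))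
      + 6 * (D + (2 * k + 3) / (5 * K ^ 9) + 3 / K ^ 9) / K ^ 9 ≤ δ)
    (hL : 242 * log K / K ^ 10 + 37 * (D + (2 * k + 3) / (5 * K ^ 9) + 4 / K ^ 9) / K ^ 9 ≤ L)
    (hNW : (√P₁ + ((N : ℝ) - 1) * (U / K ^ 9) + δ * K ^ 9 / 2 * log N) ^ 2
      + (3 * (k * π / ((25 / 16 - 1 / 10 ^ 6) * K ^ 10 - 1) + 1 / K ^ 19
      + 310 * log K / K ^ 9) / 10 + 6 / K ^ 9) + δ ≤ 1 / 50)
    {m : ℕ} (hm : 1 ≤ m) (hmN : m + 1 ≤ N) {r θ : ℝ}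
    (hrung : SwingRung K ε ρ X k r₀ P₁ A₀ D₀ U δ L m r θ) :
    ∃ r' θ' : ℝ, r + 1 ≤ r' ∧ SwingRung K ε ρ X k r₀ P₁ A₀ D₀ U δ L (m + 1) r' θ' := by
  unfold SwingRung at hrung ⊢
  obtain ⟨hk1, -, -, hδ0, -, -⟩ := rung_numerics hK hε hρ hlo k hk
  have hK0 : (0 : ℝ) < K := by linarith
  have hK8 : (0 : ℝ) < K ^ 8 := by positivity
  have hK9 : (0 : ℝ) < K ^ 9 := by positivity
  have hK10 : (0 : ℝ) < K ^ 10 := by positivity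
  have hk0 : (0 : ℝ) ≤ k := Nat.cast_nonneg k
  have hlogK : 0 ≤ log K := Real.log_nonneg (by linarith)
  have h310 : (0 : ℝ) ≤ 310 * log K / K ^ 9 := div_nonneg (mul_nonneg (by norm_num) hlogK) hK9.le
  have h6 : (0 : ℝ) ≤ 6 / K ^ 9 := by positivity
  have h3 : (0 : ℝ) ≤ 3 / K ^ 9 := by positivity
  have hD0 : 0 ≤ D₀ := le_trans (abs_nonneg _) hD₀
  obtain ⟨s, hs_def⟩ : ∃ s : ℝ, s = 3 * (k * π / ((25 / 16 - 1 / 10 ^ 6) * K ^ 10 - 1)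
      + 1 / K ^ 19 + 310 * log K / K ^ 9) / 10 + 6 / K ^ 9 := ⟨_, rfl⟩
  have hs0 : 0 ≤ s := by rw [hs_def]; linarith only [hδ0, h310, h6]
  obtain ⟨J, hJ_def⟩ : ∃ J : ℝ, J = (61 / 12 * k + 2 / 3) / K ^ 10 + 3 / K ^ 9 := ⟨_, rfl⟩
  have hJ0 : 0 ≤ J := by rw [hJ_def]; positivity
  obtain ⟨ι, hι_def⟩ : ∃ ι : ℝ, ι = (2 * k + 3) / (5 * K ^ 9) := ⟨_, rfl⟩
  have hι0 : 0 ≤ ι := by rw [hι_def]; positivity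
  obtain ⟨u, hu_def⟩ : ∃ u : ℝ, u = U / K ^ 9 := ⟨_, rfl⟩
  obtain ⟨cL, hcL_def⟩ : ∃ cL : ℝ, cL = δ * K ^ 9 / 2 := ⟨_, rfl⟩
  obtain ⟨hDnn, hU0, -⟩ := clock_slip_signs hK hk1 hD0 hD hU le_rfl
  obtain ⟨hfine0, hfine6, -, hl0⟩ := sharp_clock_signs hK hDnn
    (by positivity : (0 : ℝ) ≤ (2 * k + 3) / (5 * K ^ 9)) hL
  have hu0 : 0 ≤ u := by rw [hu_def]; exact div_nonneg hU0 hK9.le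
  have hlogc : 0 ≤ 2 * log k + 520 * log K := by
    have : 0 ≤ log (k : ℝ) := Real.log_nonneg hk1
    linarith only [this, hlogK]
  have hu72 : 7 / 2 / K ^ 9 ≤ u := by
    have h1 : 0 ≤ (2 * log k + 520 * log K) * D ^ 2 := mul_nonneg hlogc (sq_nonneg D)
    have h2 : (7 : ℝ) / 2 ≤ U := by nlinarith only [hU, h1, sq_nonneg (k : ℝ)]
    rw [hu_def]; exact div_le_div_of_nonneg_right h2 hK9.le
  obtain ⟨A, hA_def⟩ : ∃ A : ℝ, A = 723 * log K / K ^ 10 + 1972 / 1000 := ⟨_, rfl⟩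
  obtain ⟨c, hc_def⟩ : ∃ c : ℝ,
      c = 21 * ε ^ 2 + 1 / (10 ^ 6 * K ^ 10) + 1 / K ^ 18 + 6 / K ^ 40 := ⟨_, rfl⟩
  obtain ⟨hA723, hc0, -⟩ := ladder_balance_numerics hK hεK le_rfl hK9.le hL42
  rw [← hc_def] at hc0
  have hApos : 0 ≤ A := by rw [hA_def]; linarith only [hA723]
  have hLs : L ≤ 1 / 10 ^ 6 := by
    have hK9' : (16 : ℝ) ^ 9 ≤ K ^ 9 := pow_le_pow_left₀ (by norm_num) hK 9
    have h1 : 42 / K ^ 9 ≤ 42 / 16 ^ 9 := div_le_div_of_nonneg_left (by norm_num) (by norm_num) hK9'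
    norm_num at h1
    linarith only [hL42, h1]
  have numer : ∀ m' : ℝ, 0 ≤ m' → m' ≤ K ^ 9 →
      25 / 16 + (A * (1 / 50) + (3 + 1 / 10 ^ 6) * (1415 / 10000) / K) + m' * c
        ≤ (139 / 100) ^ 2 - 278 / 100 * L := by
    intro m' h0' h9'
    have := (ladder_balance_numerics hK hεK h0' h9' hL42).2.2
    rwa [← hA_def, ← hc_def] at this
  have floor : ∀ {θ e m' : ℝ},
      (139 / 100) ^ 2 - 278 / 100 * L ≤ min (θ ^ 2) ((139 / 100) ^ 2)
        + (A * e ^ 2 + (3 + 1 / 10 ^ 6) * e / K) + m' * c →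
      25 / 16 + (A * (1 / 50) + (3 + 1 / 10 ^ 6) * (1415 / 10000) / K) + m' * c
        ≤ (139 / 100) ^ 2 - 278 / 100 * L →
      0 < θ → 0 ≤ e → e ^ 2 ≤ 1 / 50 → 5 / 4 ≤ θ := by
    intro θ e m' hinv hnum hθ he he2
    rw [hA_def, hc_def] at hinv hnum
    exact ladder_clock_floor hK hinv hnum hA723 hθ he he2
  simp only [← hs_def, ← hJ_def, ← hι_def, ← hA_def, ← hc_def, ← hu_def, ← hcL_def]
    at hNW hD hδ hL hrung ⊢
  have hcold6 : 0 ≤ 6 * (D + ι + 3 / K ^ 9) / K ^ 9 :=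
    div_nonneg (mul_nonneg (by norm_num) (by linarith only [hDnn, hι0, h3])) hK9.le
  have h2Dι : 0 ≤ (2 * D + ι) * ι := mul_nonneg (by linarith only [hDnn, hι0]) hι0
  have hδpos : 0 ≤ δ := by linarith only [hδ, hcold6, h2Dι]
  have hcL0 : 0 ≤ cL := by rw [hcL_def]; positivity
  have hP₁0 : 0 ≤ P₁ := le_trans (by positivity) hP₁
  have hWmono : ∀ n' : ℝ, 1 ≤ n' → n' ≤ N →
      √P₁ + (n' - 1) * u + cL * log n' ≤ √P₁ + ((N : ℝ) - 1) * u + cL * log N :=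
    fun n' h1 h2 => pair_window_mono hu0 hcL0 h1 h2
  obtain ⟨hr, hb, hθ1, hθhi, hc, hW, hP50, hA, hd1, hd2, hinv⟩ := hrung
  have hm1 : (1 : ℝ) ≤ m := by exact_mod_cast hm
  have hmN' : (m : ℝ) + 1 ≤ N := by exact_mod_cast hmN
  have hmK9 : (m : ℝ) ≤ K ^ 9 := by linarith only [hmN', hN9]
  have hr0 : 0 ≤ r := by linarith only [hr₀, hr, hm1]
  have hPr : X r 3 ^ 2 + X r 4 ^ 2 + 3 * (k * π / ((25 / 16 - 1 / 10 ^ 6) * K ^ 10 - 1)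
      + 1 / K ^ 19 + 310 * log K / K ^ 9) / 10 + 6 / K ^ 9 ≤ 1 / 50 := by
    have h := hP50; rw [hs_def] at h; linarith only [h]
  obtain ⟨T', θ₁, ⟨hrT, -, -, -, hbT, hθ₁lo, hθ₁hi, hfloor, hcT, -, he0, hecr, hfl, hceil,
      hdT⟩, hΛlo, hΛhi, hdebit⟩ :=
    knob_pulse_debit hX h0 hC hK hε hεK hρ hlo hhi k hk hr0 hθ1 hθhi hb hc hPr
  have hT'0 : 0 ≤ T' := by linarith only [hr0, hrT]
  have em1 : ((m : ℝ) - 1) + 1 = m := by ring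
  have hdD : |X r 3| ≤ D :=
    (ledger_invariant_final hK0 hJ0 (by linarith only [hm1]) hd1 (by rw [em1]; exact hd2)).trans
      hD
  have ha0 : 0 ≤ X r 4 :=
    le_trans (add_nonneg hA0 (div_nonneg (by linarith only [hm1]) hK9.le)) hA
  have haP : X r 4 ^ 2 ≤ 1 / 50 := by nlinarith only [hP50, hs0, sq_nonneg (X r 3)]
  have heT : K * X T' 4 ≤ 3 / 20 * K := by
    have h2a : X r 4 ≤ 1415 / 10000 := by nlinarith only [haP, ha0]
    have : X T' 4 ≤ 3 / 20 := by linarith only [hecr, pulse_gain_crude hK, h2a]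
    nlinarith only [this, hK0]
  obtain ⟨-, hι⟩ := iota_numerics hK hk0 (mul_nonneg hK0.le he0) heT
  rw [← hι_def] at hι
  have hdT' : |X T' 3| ≤ |X r 3| + ι := by linarith only [hdT, hι]
  -- THE CEILING OF THE RUNG (part 90 §261's `7/2 + k²/3 + (2 log k + 520 log K)d²`)
  have hd2D : X r 3 ^ 2 ≤ D ^ 2 := by
    have := pow_le_pow_left₀ (abs_nonneg _) hdD 2
    rwa [sq_abs] at this
  have hUr : 7 / 2 + k ^ 2 / 3 + (2 * log k + 520 * log K) * X r 3 ^ 2 ≤ U := by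
    have := mul_le_mul_of_nonneg_left hd2D hlogc
    linarith only [this, hU]
  have haT' : X T' 4 ≤ X r 4 + u := by
    rw [hu_def]; linarith only [hceil, div_le_div_of_nonneg_right hUr hK9.le]
  have haa' : X r 4 ≤ X T' 4 := by
    have : (0 : ℝ) < 1 / K ^ 9 := by positivity
    linarith only [hfl, this]
  -- THE SQUARE-ROOT PULSE SLIP (part 96 §270) in place of part 82 §239's linear one
  have slip := pulse_pslip_sqrt ha0 haT' haa' hdT' hdD hι0
  have hxm : ((m : ℝ) + 1) / K ^ 9 ≤ √(X r 3 ^ 2 + X r 4 ^ 2) + u := by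
    have h1 := output_le_sqrt_pair (d := X r 3) ha0
    have e : ((m : ℝ) + 1) / K ^ 9 = ((m : ℝ) - 1) / K ^ 9 + 2 / K ^ 9 := by ring
    have h2 : (2 : ℝ) / K ^ 9 ≤ 7 / 2 / K ^ 9 := div_le_div_of_nonneg_right (by norm_num) hK9.le
    linarith only [h1, hA, hA0, hu72, e, h2]
  have hlogm : log (m : ℝ) ≤ log ((m : ℝ) + 1) :=
    Real.log_le_log (by linarith only [hm1]) (by linarith only [hm1])
  have hWm1 : √(X r 3 ^ 2 + X r 4 ^ 2) + u
      ≤ √P₁ + ((m : ℝ) + 1 - 1) * u + cL * log ((m : ℝ) + 1) := by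
    have := mul_le_mul_of_nonneg_left hlogm hcL0
    linarith only [hW, this]
  have hWN := hWmono ((m : ℝ) + 1) (by linarith only [hm1]) hmN'
  have hx0 : 0 ≤ √(X r 3 ^ 2 + X r 4 ^ 2) + u := add_nonneg (Real.sqrt_nonneg _) hu0
  have hx2 : (√(X r 3 ^ 2 + X r 4 ^ 2) + u) ^ 2
      ≤ (√P₁ + ((N : ℝ) - 1) * u + cL * log N) ^ 2 :=
    pow_le_pow_left₀ hx0 (hWm1.trans hWN) 2
  have hPT : X T' 3 ^ 2 + X T' 4 ^ 2 ≤ 1 / 50 := by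
    linarith only [slip, hδ, hcold6, hx2, hNW, hs0]
  have hθ₁1 : 1249 / 1000 ≤ θ₁ := by linarith only [hθ₁lo, hθ1, hfine6]
  have hθ₁2 : θ₁ ≤ 3 / 2 := by linarith only [hθ₁hi, hθhi, hfine6]
  have h37 : 37 * (|X T' 3| + 4 / K ^ 9) / K ^ 9 ≤ L := by
    have h := div_le_div_of_nonneg_right (show 37 * (|X T' 3| + 4 / K ^ 9)
      ≤ 37 * (D + ι + 4 / K ^ 9) by linarith only [hdT', hdD]) hK9.le
    linarith only [h, hL, hfine0]
  -- THE COLD HALF (part 92 §265 in the credit band, else part 87 §255) + part 93's invariant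
  obtain ⟨tz, r', θ', ⟨htz1, -, htz2, hr'3, hcold, hc'⟩, ⟨hb', hθ'hi, hθ'lo, hpair⟩,
      ⟨-, hdr', hmono, -, -⟩, hclk⟩ :
      ∃ tz r' θ' : ℝ, (T' + 1 ≤ tz ∧ X tz 1 = 0 ∧ tz < r' ∧ r' < T' + 3 ∧
        (∀ t ∈ Icc T' r', X t 2 ≤ ρ ^ 2 / K ^ 9) ∧ X r' 2 = ρ ^ 2 / K ^ 9) ∧
        (X r' 1 = θ' * ε ∧ θ' ≤ 141422 / 100000 ∧
          (θ₁ - 37 * (|X T' 3| + 4 / K ^ 9) / K ^ 9 ≤ θ' ∨ 139999 / 100000 ≤ θ') ∧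
          |X r' 3 ^ 2 + X r' 4 ^ 2 - (X T' 3 ^ 2 + X T' 4 ^ 2)|
            ≤ 6 * (|X T' 3| + 3 / K ^ 9) / K ^ 9) ∧
        (9 / 4 ≤ r' - T' ∧ |X r' 3| ≤ |X T' 3| * exp (-(9 / 4 * (K * X T' 4))) + 3 / K ^ 9 ∧
          X T' 4 ≤ X r' 4 ∧ X r' 4 ≤ X T' 4 + 3 * K * (|X T' 3| + 3 / K ^ 9) ^ 2 ∧
          ∀ t ∈ Icc T' r', |X t 3| ≤ |X T' 3| + 3 / K ^ 9) ∧
        (139 / 100) ^ 2 - 278 / 100 * L ≤ min (θ' ^ 2) ((139 / 100) ^ 2)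
          + (A * X r' 4 ^ 2 + (3 + 1 / 10 ^ 6) * X r' 4 / K) + (m : ℝ) * c := by
    rcases le_or_gt θ₁ (139 / 100) with hband | hband
    · obtain ⟨tz, r', θ', h1, h2, h3, -, -, hcredit⟩ :=
        knob_cold_credit hX h0 hK hε hεK hρ hhi hT'0 hθ₁1 hband hbT hPT hfloor hcT he0
      refine ⟨tz, r', θ', h1, h2, h3, ?_⟩
      have hmo : X T' 4 ≤ X r' 4 := h3.2.2.1
      have hbal := rung_balance_in_band hK hdebit hcredit hΛlo hΛhi ha0 haa' hmo
      have hFm := balance_weight_mono hK ha0 (haa'.trans hmo) hc0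
      rw [← hA_def, ← hc_def] at hbal
      rw [← hA_def] at hFm
      have step := capped_step_in_band (C := ((139 : ℝ) / 100) ^ 2) (θ2 := θ ^ 2)
        (θ'2 := θ' ^ 2)
        (F := A * X r 4 ^ 2 + (3 + 1 / 10 ^ 6) * X r 4 / K + ((m : ℝ) - 1) * c)
        (F' := A * X r' 4 ^ 2 + (3 + 1 / 10 ^ 6) * X r' 4 / K + (m : ℝ) * c)
        (by linarith only [hbal]) (by linarith only [hFm])
      linarith only [step, hinv]
    · obtain ⟨tz, r', θ', h1, h2, h3⟩ :=
        knob_cold_half_sharp hX h0 hK hε hεK hρ hhi hT'0 hθ₁1 hθ₁2 hbT hPT hfloor hcT he0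
      refine ⟨tz, r', θ', h1, h2, h3, ?_⟩
      have hθ'L := out_band_floor hband hl0 h37 h2.2.2.1
      have he'0 : 0 ≤ X r' 4 := ha0.trans (haa'.trans h3.2.2.1)
      have hF' : 0 ≤ A * X r' 4 ^ 2 + (3 + 1 / 10 ^ 6) * X r' 4 / K + (m : ℝ) * c :=
        add_nonneg (add_nonneg (mul_nonneg hApos (sq_nonneg _))
          (div_nonneg (mul_nonneg (by norm_num) he'0) hK0.le))
          (mul_nonneg (by linarith only [hm1]) hc0)
      have := capped_step_out_band hl0 (by linarith only [hLs]) hθ'L hF'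
      linarith only [this]
  have hθ'pos : 0 < θ' := rung_exit_pos hθ₁1 (by linarith only [h37, hLs]) hθ'lo
  -- THE PAIR SLIP OF THE RUNG ON THE √P LEDGER (part 96 §270): `P(r') ≤ x² + δ`
  have hcold' : 6 * (|X T' 3| + 3 / K ^ 9) / K ^ 9 ≤ 6 * (D + ι + 3 / K ^ 9) / K ^ 9 :=
    div_le_div_of_nonneg_right (by linarith only [hdT', hdD]) hK9.le
  have hP'x : X r' 3 ^ 2 + X r' 4 ^ 2 ≤ (√(X r 3 ^ 2 + X r 4 ^ 2) + u) ^ 2 + δ := by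
    have h1 := (abs_le.1 hpair).2
    linarith only [h1, hcold', slip, hδ]
  have hstep := sqrt_ledger_step hK9 hm1 hδpos hxm hP'x
  rw [← hcL_def] at hstep
  obtain ⟨x, hx⟩ : ∃ x : ℝ, x = K * X T' 4 := ⟨_, rfl⟩
  have hmK : (m : ℝ) / K ^ 9 ≤ X T' 4 := by
    have e : ((m : ℝ) - 1) / K ^ 9 + 1 / K ^ 9 = (m : ℝ) / K ^ 9 := by ring
    linarith only [hA, hfl, hA0, e]
  have hxm' : (m : ℝ) / K ^ 8 ≤ x := by
    have e : K * ((m : ℝ) / K ^ 9) = (m : ℝ) / K ^ 8 := by field_simp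
    rw [hx, ← e]; exact mul_le_mul_of_nonneg_left hmK hK0.le
  have hx0' : 0 ≤ x := le_trans (by positivity) hxm'
  have hq0 : 0 ≤ exp (-(9 / 4 * x)) := (exp_pos _).le
  have hq1 : exp (-(9 / 4 * x)) ≤ 1 := by rw [Real.exp_le_one_iff]; linarith only [hx0']
  have hinj : exp (-(9 / 4 * x)) * (5 * k + (k / 2 + 4) * x) ≤ 61 / 12 * k + 2 / 3 := by
    have f1 := mul_le_of_le_one_left (by positivity : (0 : ℝ) ≤ 5 * k) hq1
    have f2 := mul_le_mul_of_nonneg_left (injection_numerics x)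
      (by positivity : (0 : ℝ) ≤ k / 2 + 4)
    linarith only [f1, f2]
  have hinj' : exp (-(9 / 4 * x)) * ((5 * k + (k / 2 + 4) * x) / K ^ 10)
      ≤ (61 / 12 * k + 2 / 3) / K ^ 10 := by
    rw [← mul_div_assoc]; exact div_le_div_of_nonneg_right hinj hK10.le
  rw [← hx] at hdT hdr'
  have hprod := mul_le_mul_of_nonneg_right hdT hq0
  have hrec : |X r' 3| ≤ exp (-(9 / 4 * x)) * |X r 3| + J := by
    rw [hJ_def]; linarith only [hdr', hprod, hinj']
  have hy : 9 / 4 * (((m : ℝ) - 1) + 1) / K ^ 8 ≤ 9 / 4 * x := by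
    rw [em1, mul_div_assoc]; linarith only [hxm']
  obtain ⟨hd1', hd2'⟩ := ledger_invariant_step hK0 hJ0 hD0 (abs_nonneg _)
    (by linarith only [hm1]) hy hd1 (by rw [em1]; exact hd2) hrec
  have em : ((m : ℝ) - 1) + 2 = (m : ℝ) + 1 := by ring
  rw [em] at hd2'
  -- the clock floor of the next rung from the invariant ALONE (part 93 §267)
  have he'0 : 0 ≤ X r' 4 := ha0.trans (haa'.trans hmono)
  have hPr'50 : X r' 3 ^ 2 + X r' 4 ^ 2 + s ≤ 1 / 50 := by
    linarith only [hP'x, hx2, hNW]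
  have he'2 : X r' 4 ^ 2 ≤ 1 / 50 := by
    nlinarith only [hPr'50, hs0, sq_nonneg (X r' 3)]
  have hθ'1 : 5 / 4 ≤ θ' := floor hclk (numer m (by positivity) hmK9) hθ'pos he'0 he'2
  refine ⟨r', θ', by linarith only [hrT, htz1, htz2], ?_, hb', hθ'1, by linarith only [hθ'hi],
    hc', ?_, hPr'50, ?_, ?_, ?_, ?_⟩
  · push_cast; linarith only [hr, hrT, htz1, htz2]
  · push_cast; linarith only [hstep, hW]
  · have e' : (((m + 1 : ℕ) : ℝ) - 1) / K ^ 9 = ((m : ℝ) - 1) / K ^ 9 + 1 / K ^ 9 := by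
      push_cast; ring
    linarith only [hA, hfl, hmono, e']
  · push_cast; linarith only [hd1']
  · push_cast; exact hd2'
  · push_cast
    have e' : ((m : ℝ) + 1 - 1) * c = (m : ℝ) * c := by ring
    rw [e']; exact hclk

end Summit.NavierStokesRegularity.FluidComputer.GateBudget

end
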